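import Summits.QuantumFields.YangMills.Theorems.FluctuationComparisonRegPrIntLS2BetaArcLetterOfGuard
import Summits.QuantumFields.YangMills.Theorems.FluctuationComparisonRegPrIntLS2BetaLiftLadderCombRow
import HarnessLib

/-!
# S2β · THE SUP CHAIN ∕ (D-stage): (RSP-Σ) AT THE STATION PREFIX — the level sum of the relative stage chords is LINEAR in the station's exponent sum
# `Σθ_G := Σ_{i<K−J} ((5L)²∕4)·θ(K−i)`: `Σ_{t<K−J} M(t+1) ≤ E₀(L) + E₁(L)·Σθ_G` (and the same for squares), from the SUP window only — NO `Σθ` WINDOW, NO `γ, b₀, p₀`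

Cell `ym3-torus` (rung R3 = continuum `SU(2)` Yang–Mills on T³ at fixed lattice data — NOT d = 4, NOT infinite volume, NOT a mass gap, NOT Clay).  Width seat «width 12»
`ym3-torus-px12` (gen 26), FREE px helper on crux `stmt-QuantumFields-20520`; `--supports` helper, count-neutral, DEFINITION-FREE (0 `def`∕`instance`∕`notation`∕`sorry`,
default heartbeats).

WHY (ruling px17 g22 19:55:50Z (RSP-Σ): «`Σ_j s_j ≤ πL∕(L−c) + 2CL²·Σθ`», HOLDER px12; px10 g26's c₁ BUDGET CORE takes (RSP-Σ) as a NAMED hypothesis at the station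
prefix).  The landed editions ✓p833422 `relChordSum_of_smallBond_axStage` ∕ ✓p834939 `relChordSum_theta_axStage` REQUIRE the level-sum WINDOW `Σ_{i<K−J} θ′(K−i) ≤ S₀(L)`;
the station prefix (✓p834059, LEAD's knit v3, `hSCT₁_fb`) has NO such window — only the sup window `((5L)²∕4)·θ i ≤ α` (`J < i ≤ K`) and `Σθ_G` inside the EXPONENT
of the budget.  At the station the right letter is the ruling's LINEAR form, elementary after ✓`…ArcLetterOfGuard`'s sup-window bootstrap: once every gauged level
obeys `s_t ≤ M(L)`, the guarded quadratic step LINEARISES to `s_t ≤ q·s_{t+1} + ρ_t` (`q := r₀ + C₂·M < 1`) and ✓`sum_succ_le_of_contract_start` sums it, with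
`Σ_{t<K−J} ρ_t ≤ (A₁+A₂)∕G·Σθ_G + A₂·(C_B·α + ε₁)` and `A₂·C_B·α ≤ A₂·C_B·α₀ ≤ Smax∕2`: `E₀ := (q·M + Smax)∕(1−q) + M`, `E₁ := (A₁+A₂)∕(G·(1−q))`, both `C_B`-FREE;
squares by ✓`sum_sq_succ_le_mul_sum_succ`.  §2 = the two gauged towers at the STATION PREFIX VERBATIM (LEAD knit DRAFT-v3 l.81–132 == `hARC`'s prefix) in the
raw-chord currency of ✓p834939 (`M := s + s′`; ✓`norm_logVec_rawChord_eq_stageChord` + ✓`norm_logVec_mul_inv_le_add`), memberships as in ✓`arcLetter_of_guard`;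
the consumer puts `E₀ + E₁·x ≤ (E₀ + E₁)·e^{x}` (`Real.add_one_le_exp`) into the station's `exp(c·Σθ_G)` slot.

WHAT IS PROVED (sorry-free).  ★★`exists_alpha_supBudget_window` (one tower: `∃ α₀(L,C_B) > 0, ∃ E₀(L), E₁(L) ≥ 0`; sup window + top (BKG) + datum guard ⟹ `s ≥ 0`
bounding the arcs, `s_t ≤ 1∕4`, `Σ_{t<K−J} s(t+1) ≤ E₀ + E₁·Σθ_G`, same for squares), ★★★`relChordSum_of_guard G hGs` (two towers at the station prefix: `∃ M ≥ 0`,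
raw relative chords `≤ M_t ≤ 1∕2` (`t ≤ K−J`), `Σ_{t<K−J} M(t+1) ≤ E₀ + E₁·Σθ_G`, same for squares).

HONEST SCOPE.  Elementary bootstrap∕summation + re-plumbing of landed letters; window, (BKG), (E4), memberships, the 17 `AxStage` clauses are HYPOTHESES; nothing of
Bałaban's renormalisation-group analysis is asserted or proved ([Balaban1985RegularSpaces] Lemma 1 (1.24)–(1.26) p.79, (1.29) p.81; [Balaban1985Averaging] Prop. 4
(128)–(135) pp.37–38 — printed conventions).  The c₁ core, the SUPPLIER KNIT, `hDBX`, LIFT-LADDER's inhabitant, (ST″), LOC, D-GUARD (unguarded `G`), GAP♯∘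
(`stub_uniformFibreGapOrbit`, registry 3732b7df UNTOUCHED), the five registered stubs (0∕5), S2β, 20520, 19936, 19200, `YM3TorusSU2` are NOT proved; no registered stub
is closed; rung R3 — NOT d = 4, NOT infinite volume, NOT a mass gap, NOT Clay; the Yang–Mills mass gap is NOT proved.
-/

set_option autoImplicit false

noncomputable section

namespace Summit.QuantumFields.YangMills.Theorems.FluctuationComparisonRegPrIntLS2BetaRelChordSumOfGuard

open Finset
open scoped Real
open Literature.MathematicalPhysics.QuantumLattice (su2Quat)
open Literature.MathematicalPhysics.QuantumFieldTheory.Balaban1983to89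
open T4Continuum T3ContinuumYM3Torus T3UnitScaleTilt T3TiltDescent T3LevelShift BlockAveraging
open T4CubeChartGnomonic (SU2)
open T4HaarSU2ExpChart (expPoint)
open T4ExpWindowSmallField (logVec)
open T3UnitLawDensityEML (ℰp)
open T3ConstrainedMinimiser (fibre)
open ExpMeanLog (deltaSU)
open B10Eq27TorusAxialLog (rel axialT)
open Summit.QuantumFields.YangMills.Theorems.FluctuationComparisonRegPrIntLS2BetaRelativeTowerSupProfileStart (exists_supProfile_relativeTower_start)
open Summit.QuantumFields.YangMills.Theorems.FluctuationComparisonRegPrIntLS2BetaRelativeTowerSupBudgetStart (norm_logVec_iter_le_of_mem_fibre)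
open Summit.QuantumFields.YangMills.Theorems.FluctuationComparisonRegPrIntLS2BetaRelativeTowerSupBudget128 (one_div_128_le_ceiling)
open Summit.QuantumFields.YangMills.Theorems.FluctuationComparisonRegPrIntLS2BetaContractingSupStart (sum_succ_le_of_contract_start sum_sq_succ_le_mul_sum_succ)
open Summit.QuantumFields.YangMills.Theorems.FluctuationComparisonRegPrIntLS2BetaResidualGauge
  (gaugeAct_mul_eq gaugeAct_mem_fibre_iff_of_residual gaugeAct_mem_histGood_iff)
open Summit.QuantumFields.YangMills.Theorems.FluctuationComparisonRegPrIntLS2BetaHFlatOfRelativeLetter (residual_of_iter_eq)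
open Summit.QuantumFields.YangMills.Theorems.FluctuationComparisonRegPrIntLS2BetaPeanoSmooth (iter_eq_of_descendTo_eq)
open Summit.QuantumFields.YangMills.Theorems.FluctuationComparisonRegPrIntLS2BetaArcLetterOfGuard (sup_bootstrap_start_pointwise)
open Summit.QuantumFields.YangMills.Theorems.FluctuationComparisonRegPrIntLS2BetaLiftLadderCombRow (norm_logVec_rawChord_eq_stageChord norm_logVec_mul_inv_le_add)

/-! ## §1 One tower: the sup profile AND its level sums from the α-window, the top (BKG) clause and the datum's guard -/

/-- ★★ **THE SUP BUDGET OF A STAGE TOWER IN THE GUARD `1∕128`, SUP-WINDOW EDITION WITH LEVEL SUMS**: `∃ α₀(L, C_B) > 0, ∃ E₀(L), E₁(L) ≥ 0`: sup window on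
`J < i ≤ K`, `α ≤ 1∕24`, `α < δ_SU`, `α ≤ α₀`, datum guard `1∕128`, `U ∈ fibre ∩ histGood(θ)` with top plaquettes `≤ C_B·α`, gauged stage tower ⟹ a profile `s ≥ 0`
bounding the arcs (`t ≤ K−J`) with `s_t ≤ 1∕4`, `Σ_{t<K−J} s(t+1) ≤ E₀ + E₁·Σ_{i<K−J} ((5L)²∕4)·θ(K−i)`, same for squares. [cite: Balaban1985RegularSpaces, Lemma 1 (1.24)-(1.26) p.79, (1.29) p.81] -/
theorem exists_alpha_supBudget_window (L : ℕ) (hL : 1 < L) (C_B : ℝ) (hCB : 0 ≤ C_B) :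
    ∃ α₀ : ℝ, 0 < α₀ ∧ ∃ E₀ : ℝ, 0 ≤ E₀ ∧ ∃ E₁ : ℝ, 0 ≤ E₁ ∧ ∀ (F : T3Family) (θ : ℕ → ℝ), F.L = L → (∀ i, 0 ≤ θ i) →
      ∀ (J K : ℕ) (hJK : J ≤ K) (α : ℝ), (∀ i, J < i → i ≤ K → (((5 * F.L : ℕ) : ℝ) ^ 2 / 4) * θ i ≤ α) →
      α ≤ 1 / 24 → α < deltaSU (Fin 2) → α ≤ α₀ →
      ∀ (Vd : GaugeField (F.P J) 0 SU2), (∀ e, ‖logVec (su2Quat (Vd e))‖ ≤ 1 / 128) →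
      ∀ (U : GaugeField (F.P K) 0 SU2), U ∈ fibre F ℰp J K hJK Vd → U ∈ histGood F ℰp θ K J →
      (∀ p : Plaq (F.P K) (K - J),
        dist1 (GaugeField.plaqHol (Averaging.iter (fun k => blockAvg (P := F.P K) (j := k) ℰp) (K - J) U) p) ≤ C_B * α) →
      ∀ (g : (j : ℕ) → Site (F.P K) j → SU2) (w : (t : ℕ) → PBond (F.P K) t → PBond (F.P K) (t + 1) → ℝ)
        (V : (t : ℕ) → GaugeField (F.P K) t SU2),
        (∀ t, t < K - J → ∀ b e, w t b e = if e.dir = b.dir ∧ (b.src b.dir - emb e.src b.dir).val < (F.P K).L then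
          ∏ ν ∈ Finset.univ.erase b.dir, max 0 (1 - ((rel (emb e.src) b.src ν).natAbs : ℝ) / (F.P K).L) else 0) →
        (∀ t, t < K - J → ∀ b, V t b = expPoint (∑ e, w t b e • ((((F.P K).L : ℕ) : ℝ)⁻¹ •
          logVec (su2Quat (GaugeField.gaugeAct (g (t + 1)) (Averaging.iter (fun k => blockAvg (P := F.P K) (j := k) ℰp) (t + 1) U) e))))) →
        (∀ j, K - J ≤ j → ∀ y, g j y = 1) →
        (∀ t, t < K - J → ∀ z : Site (F.P K) t,
          axialT (GaugeField.gaugeAct (g t) (Averaging.iter (fun k => blockAvg (P := F.P K) (j := k) ℰp) t U)) (emb (blockOf z)) z =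
            axialT (V t) (emb (blockOf z)) z) →
        (∀ t, t < K - J → avgFun ℰp (GaugeField.gaugeAct (g t) (Averaging.iter (fun k => blockAvg (P := F.P K) (j := k) ℰp) t U)) =
          GaugeField.gaugeAct (g (t + 1)) (Averaging.iter (fun k => blockAvg (P := F.P K) (j := k) ℰp) (t + 1) U)) →
        ∃ s : ℕ → ℝ, (∀ t, 0 ≤ s t) ∧
          (∀ t, t ≤ K - J → ∀ b, ‖logVec (su2Quat (GaugeField.gaugeAct (g t) (Averaging.iter (fun k => blockAvg (P := F.P K) (j := k) ℰp) t U) b))‖ ≤ s t) ∧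
          (∀ t, t ≤ K - J → s t ≤ 1 / 4) ∧
          ∑ t ∈ Finset.range (K - J), s (t + 1) ≤ E₀ + E₁ * ∑ i ∈ Finset.range (K - J), (((5 * F.L : ℕ) : ℝ) ^ 2 / 4) * θ (K - i) ∧
          ∑ t ∈ Finset.range (K - J), s (t + 1) ^ 2 ≤ E₀ + E₁ * ∑ i ∈ Finset.range (K - J), (((5 * F.L : ℕ) : ℝ) ^ 2 / 4) * θ (K - i) := by
  have hL' : (1 : ℝ) < L := by exact_mod_cast hL
  obtain ⟨NP, hNP, hNP0⟩ : ∃ x : ℝ, x = (((3 - 1) * ((L - 1) / 2) * (L + 1) : ℕ) : ℝ) ∧ 0 ≤ x := ⟨_, rfl, by positivity⟩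
  obtain ⟨G, hG, hG0⟩ : ∃ x : ℝ, x = ((((3 + 2) * L : ℕ) : ℝ) ^ 2 / 4) ∧ 0 < x := ⟨_, rfl, by positivity⟩
  obtain ⟨A₁, hA₁, hA₁0⟩ : ∃ x : ℝ, x = π / 2 * (NP + 2 * G) ∧ 0 ≤ x := ⟨_, rfl, by positivity⟩
  obtain ⟨A₂, hA₂, hA₂0⟩ : ∃ x : ℝ, x = π / 2 * (NP * ((L : ℝ)⁻¹) ^ 2 * (π / 2)) ∧ 0 ≤ x := ⟨_, rfl, by positivity⟩
  obtain ⟨C₂, hC₂, hC₂0⟩ : ∃ x : ℝ, x = π / 2 * NP * 24 * ((L : ℝ)⁻¹) ^ 2 ∧ 0 ≤ x := ⟨_, rfl, by positivity⟩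
  obtain ⟨r₀, hr₀, hr00⟩ : ∃ x : ℝ, x = (L : ℝ)⁻¹ ∧ 0 ≤ x := ⟨_, rfl, by positivity⟩
  have hr01 : r₀ < 1 := by rw [hr₀]; exact inv_lt_one_of_one_lt₀ hL'
  have h1r : 0 < 1 - r₀ := by linarith
  obtain ⟨M, hM⟩ : ∃ x : ℝ, x = min (1 / 4) ((1 - r₀) / (2 * (C₂ + 1))) := ⟨_, rfl⟩
  have hM0 : 0 < M := by rw [hM]; exact lt_min (by norm_num) (by positivity)
  have hM4 : M ≤ 1 / 4 := by rw [hM]; exact min_le_left _ _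
  have hMC : C₂ * M ≤ (1 - r₀) / 2 := by
    have h1 : M ≤ (1 - r₀) / (2 * (C₂ + 1)) := by rw [hM]; exact min_le_right _ _
    calc C₂ * M ≤ (C₂ + 1) * ((1 - r₀) / (2 * (C₂ + 1))) := by nlinarith
      _ = (1 - r₀) / 2 := by field_simp
  obtain ⟨Smax, hSmax, hSmax0⟩ : ∃ x : ℝ, x = (1 - r₀) / 2 * M ∧ 0 < x := ⟨_, rfl, by positivity⟩
  obtain ⟨Z, hZ, hZ0⟩ : ∃ x : ℝ, x = A₁ / G + A₂ / G + A₂ * C_B ∧ 0 ≤ x := ⟨_, rfl, by positivity⟩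
  obtain ⟨α₀, hα₀, hα₀0⟩ : ∃ x : ℝ, x = Smax / (2 * (Z + 1)) ∧ 0 < x := ⟨_, rfl, by positivity⟩
  obtain ⟨ε₁, hε₁, hε₁0⟩ : ∃ x : ℝ, x = Smax / (2 * (A₂ + 1)) ∧ 0 < x := ⟨_, rfl, by positivity⟩
  obtain ⟨q, hq, hq0⟩ : ∃ x : ℝ, x = r₀ + C₂ * M ∧ 0 ≤ x := ⟨_, rfl, by positivity⟩
  have hq1 : q < 1 := by rw [hq]; linarith
  have h1q : 0 < 1 - q := by linarith
  obtain ⟨E₀, hE₀, hE₀0⟩ : ∃ x : ℝ, x = (q * M + Smax) / (1 - q) + M ∧ 0 ≤ x := ⟨_, rfl, by positivity⟩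
  obtain ⟨E₁, hE₁, hE₁0⟩ : ∃ x : ℝ, x = (A₁ + A₂) / (G * (1 - q)) ∧ 0 ≤ x := ⟨_, rfl, by positivity⟩
  have hAZ : A₂ * C_B ≤ Z := by rw [hZ]; linarith only [div_nonneg hA₁0 hG0.le, div_nonneg hA₂0 hG0.le]
  have hZα₀ : α₀ * Z ≤ Smax / 2 := by
    rw [hα₀]
    calc Smax / (2 * (Z + 1)) * Z ≤ Smax / (2 * (Z + 1)) * (Z + 1) := mul_le_mul_of_nonneg_left (by linarith) (by positivity)
      _ = Smax / 2 := by field_simp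
  have hε₁S : A₂ * ε₁ ≤ Smax / 2 := by
    rw [hε₁]
    calc A₂ * (Smax / (2 * (A₂ + 1))) ≤ (A₂ + 1) * (Smax / (2 * (A₂ + 1))) := mul_le_mul_of_nonneg_right (by linarith) (by positivity)
      _ = Smax / 2 := by field_simp
  have hsmall₁ : Smax ≤ (1 - r₀) / 2 * M := by rw [hSmax]
  have h128 : (1 : ℝ) / 128 ≤ M := by rw [hM, hC₂, hr₀, hNP]; exact one_div_128_le_ceiling L hL
  refine ⟨α₀, hα₀0, E₀, hE₀0, E₁, hE₁0, fun F θ hFL hθ0 J K hJK α hwin h24 hδ hαα Vd hVσ' U hUf hUg htop g w V hw hV hT1 hax hT5 => ?_⟩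
  have hVσ : ∀ e, ‖logVec (su2Quat (Vd e))‖ ≤ M := fun e => (hVσ' e).trans h128
  have hPd : (F.P K).d = 3 := rfl
  have hPL : (F.P K).L = L := hFL
  have hm : K - J ≤ (F.P K).m + (F.P K).K := by show K - J ≤ F.m + K; omega
  have hGF : (((5 * F.L : ℕ) : ℝ) ^ 2 / 4) = G := by rw [hG, hFL]
  obtain ⟨θg, hθg⟩ : ∃ f : ℕ → ℝ, f = fun t => if t < K - J then θ (K - t) else max (C_B * α) 0 + ε₁ := ⟨_, rfl⟩
  have hθg0 : ∀ t, 0 ≤ θg t := by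
    intro t
    by_cases ht : t < K - J
    · rw [hθg]; simp only [ht, if_true]; exact hθ0 _
    · rw [hθg]; simp only [ht, if_false]; exact add_nonneg (le_max_right _ _) hε₁0.le
  have hθU : ∀ t, t ≤ K - J → PlaqSmall (θg t) (GaugeField.gaugeAct (g t) (Averaging.iter (fun k => blockAvg (P := F.P K) (j := k) ℰp) t U)) := by
    intro t ht p
    rw [T4ReTrLipUnitary.plaqHol_gaugeAct, GaugeGroup.dist1_conj]
    rcases Nat.lt_or_ge t (K - J) with h | h
    · rw [hθg]; simp only [h, if_true]; exact hUg t (by omega) p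
    · obtain rfl : t = K - J := le_antisymm ht h
      rw [hθg]; simp only [lt_irrefl, if_false]
      exact lt_of_le_of_lt ((htop p).trans (le_max_left _ _)) (lt_add_of_pos_right _ hε₁0)
  have hwinθ : ∀ t, t < K - J → G * θ (K - t) ≤ α := by
    intro t ht
    rw [← hGF]
    exact hwin (K - t) (by omega) (by omega)
  have hg1 : ∀ t, t < K - J → (((((F.P K).d + 2) * (F.P K).L : ℕ) : ℝ) ^ 2 / 4) * θg t < ExpMeanLog.deltaSU (Fin 2) := by
    intro t ht; rw [hPd, hPL, ← hG, hθg]; simp only [ht, if_true]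
    exact (hwinθ t ht).trans_lt hδ
  have hg2 : ∀ t, t < K - J → (((((F.P K).d + 2) * (F.P K).L : ℕ) : ℝ) ^ 2 / 4) * θg t ≤ 1 / 6 := by
    intro t ht; rw [hPd, hPL, ← hG, hθg]; simp only [ht, if_true]
    exact (hwinθ t ht).trans (h24.trans (by norm_num))
  obtain ⟨s, hsm, hs0, hsb, hstep⟩ := exists_supProfile_relativeTower_start hm
    (fun t => GaugeField.gaugeAct (g t) (Averaging.iter (fun k => blockAvg (P := F.P K) (j := k) ℰp) t U)) w V hw hV hax hT5 θg hθg0 hθU hg1 hg2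
  have hstart : s (K - J) ≤ M := by
    refine hsm M fun b => ?_
    have hg0 : g (K - J) = fun _ => 1 := funext (hT1 (K - J) le_rfl)
    simp only [hg0, T4AxialGaugeFixing.gaugeAct_const_one]
    exact norm_logVec_iter_le_of_mem_fibre F hJK hUf hVσ b
  obtain ⟨ρ, hρ⟩ : ∃ f : ℕ → ℝ, f = fun t => A₁ * θg t + A₂ * θg (t + 1) := ⟨_, rfl⟩
  have hstep' : ∀ t, t < K - J → s (t + 1) ≤ 1 / 4 → s t ≤ r₀ * s (t + 1) + ρ t + C₂ * s (t + 1) ^ 2 := by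
    intro t ht h4
    have h := hstep t ht h4
    rw [hPd, hPL] at h
    refine h.trans (le_of_eq ?_)
    simp only [hρ, hA₁, hA₂, hC₂, hr₀, hNP, hG]
    ring
  -- the top threshold is within the SUM budget: `A₂·(max(C_B·α, 0) + ε₁) ≤ Smax` (`A₂·C_B·α₀ ≤ Z·α₀ ≤ Smax∕2`, `A₂·ε₁ ≤ Smax∕2`)
  have hA₂top : A₂ * (max (C_B * α) 0 + ε₁) ≤ Smax := by
    have hCtop : max (C_B * α) 0 ≤ C_B * α₀ := max_le (mul_le_mul_of_nonneg_left hαα hCB) (mul_nonneg hCB hα₀0.le)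
    have h7 : A₂ * max (C_B * α) 0 ≤ α₀ * Z :=
      calc A₂ * max (C_B * α) 0 ≤ A₂ * (C_B * α₀) := mul_le_mul_of_nonneg_left hCtop hA₂0
        _ = A₂ * C_B * α₀ := by ring
        _ ≤ Z * α₀ := mul_le_mul_of_nonneg_right hAZ hα₀0.le
        _ = α₀ * Z := mul_comm _ _
    rw [mul_add]; linarith only [h7, hZα₀, hε₁S]
  -- the POINTWISE source bound `ρ t ≤ α·Z + A₂·ε₁ ≤ Smax` (`t < K − J`), as in ✓`exists_alpha_supBound_window`
  have hρS : ∀ t, t < K - J → ρ t ≤ Smax := by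
    intro t ht
    have hα0 : 0 ≤ α := le_trans (mul_nonneg hG0.le (hθ0 (K - t))) (hwinθ t ht)
    have hαG : 0 ≤ α / G := div_nonneg hα0 hG0.le
    have hCα : 0 ≤ C_B * α := mul_nonneg hCB hα0
    have h1 : θg t ≤ α / G := by
      rw [hθg]; simp only [ht, if_true]
      rw [le_div_iff₀ hG0, mul_comm]; exact hwinθ t ht
    have h2 : θg (t + 1) ≤ α / G + C_B * α + ε₁ := by
      by_cases h : t + 1 < K - J
      · rw [hθg]; simp only [h, if_true]
        have h3 : θ (K - (t + 1)) ≤ α / G := by rw [le_div_iff₀ hG0, mul_comm]; exact hwinθ (t + 1) h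
        linarith only [h3, hCα, hε₁0]
      · rw [hθg]; simp only [h, if_false]
        rw [max_eq_left hCα]
        linarith only [hαG]
    have h3 : ρ t ≤ α * Z + A₂ * ε₁ := by
      calc ρ t = A₁ * θg t + A₂ * θg (t + 1) := by rw [hρ]
        _ ≤ A₁ * (α / G) + A₂ * (α / G + C_B * α + ε₁) := add_le_add (mul_le_mul_of_nonneg_left h1 hA₁0) (mul_le_mul_of_nonneg_left h2 hA₂0)
        _ = α * Z + A₂ * ε₁ := by rw [hZ]; ring
    have h4 : α * Z ≤ α₀ * Z := mul_le_mul_of_nonneg_right hαα hZ0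
    linarith only [h3, h4, hZα₀, hε₁S]
  have hall := sup_bootstrap_start_pointwise s ρ (K - J) r₀ C₂ (1 / 4) M Smax hstart hs0 hρS hstep' hr00 hC₂0 hM4 hsmall₁ hMC
  have hlin : ∀ t, t < K - J → s t ≤ q * s (t + 1) + ρ t := by
    intro t ht
    have hS : s (t + 1) ≤ M := hall (t + 1) (by omega)
    have h2 : C₂ * s (t + 1) ^ 2 ≤ C₂ * M * s (t + 1) := by
      rw [mul_assoc, sq]; exact mul_le_mul_of_nonneg_left (mul_le_mul_of_nonneg_right hS (hs0 (t + 1))) hC₂0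
    calc s t ≤ r₀ * s (t + 1) + ρ t + C₂ * s (t + 1) ^ 2 := hstep' t ht (hS.trans hM4)
      _ ≤ r₀ * s (t + 1) + ρ t + C₂ * M * s (t + 1) := by linarith only [h2]
      _ = q * s (t + 1) + ρ t := by rw [hq]; ring
  have hsum := sum_succ_le_of_contract_start q hq0 hq1 s ρ (K - J) hs0 hlin
  -- the source sum: `Σ_{t<m} ρ t ≤ (A₁+A₂)·Σ_{t<m} θ(K−t) + A₂·(max(C_Bα,0) + ε₁)`, and `G·Σ_{t<m} θ(K−t) = Σθ_G`
  have hθG : G * ∑ t ∈ range (K - J), θ (K - t) = ∑ i ∈ range (K - J), (((5 * F.L : ℕ) : ℝ) ^ 2 / 4) * θ (K - i) := by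
    rw [hGF, Finset.mul_sum]
  have hθsum0 : 0 ≤ ∑ t ∈ range (K - J), θ (K - t) := sum_nonneg fun t _ => hθ0 _
  have hin : ∑ t ∈ range (K - J), θg t = ∑ t ∈ range (K - J), θ (K - t) := by
    refine Finset.sum_congr rfl fun t ht => ?_
    rw [hθg]; simp only [Finset.mem_range.mp ht, if_true]
  have hshift : ∑ t ∈ range (K - J), θg (t + 1) ≤ ∑ t ∈ range (K - J), θ (K - t) + (max (C_B * α) 0 + ε₁) := by
    have hT0 : 0 ≤ max (C_B * α) 0 + ε₁ := add_nonneg (le_max_right _ _) hε₁0.le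
    rcases Nat.eq_zero_or_pos (K - J) with h0 | hpos
    · rw [h0]; simp only [Finset.range_zero, Finset.sum_empty, zero_add]; exact hT0
    · obtain ⟨m, hm'⟩ : ∃ m, K - J = m + 1 := ⟨K - J - 1, by omega⟩
      rw [hm', Finset.sum_range_succ (fun t => θg (t + 1)), Finset.sum_range_succ' (fun t => θ (K - t))]
      have htopv : θg (m + 1) = max (C_B * α) 0 + ε₁ := by rw [hθg]; simp only [hm', lt_irrefl, if_false]
      have hin' : ∑ t ∈ range m, θg (t + 1) = ∑ t ∈ range m, θ (K - (t + 1)) := by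
        refine Finset.sum_congr rfl fun t ht => ?_
        rw [hθg]; simp only [show t + 1 < K - J by have := Finset.mem_range.mp ht; omega, if_true]
      rw [htopv, hin']
      linarith only [hθ0 (K - 0)]
  have hρsum : ∑ t ∈ range (K - J), ρ t ≤ (A₁ + A₂) * ∑ t ∈ range (K - J), θ (K - t) + Smax := by
    have hs1 : ∑ t ∈ range (K - J), ρ t = A₁ * ∑ t ∈ range (K - J), θg t + A₂ * ∑ t ∈ range (K - J), θg (t + 1) := by
      simp only [hρ, sum_add_distrib, mul_sum]
    have h1 := mul_le_mul_of_nonneg_left hshift hA₂0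
    rw [hs1, hin, add_mul]
    rw [mul_add] at h1
    linarith only [h1, hA₂top]
  have hmain : ∑ t ∈ range (K - J), s (t + 1) ≤ E₀ + E₁ * ∑ i ∈ range (K - J), (((5 * F.L : ℕ) : ℝ) ^ 2 / 4) * θ (K - i) := by
    rw [← hθG, hE₀, hE₁]
    have hnum : q * s (K - J) + ∑ t ∈ range (K - J), ρ t ≤ q * M + Smax + (A₁ + A₂) * ∑ t ∈ range (K - J), θ (K - t) := by
      linarith only [mul_le_mul_of_nonneg_left hstart hq0, hρsum]
    have hdiv : (q * s (K - J) + ∑ t ∈ range (K - J), ρ t) / (1 - q) ≤ (q * M + Smax + (A₁ + A₂) * ∑ t ∈ range (K - J), θ (K - t)) / (1 - q) :=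
      div_le_div_of_nonneg_right hnum h1q.le
    have hsplit : (q * M + Smax + (A₁ + A₂) * ∑ t ∈ range (K - J), θ (K - t)) / (1 - q) + M =
        (q * M + Smax) / (1 - q) + M + (A₁ + A₂) / (G * (1 - q)) * (G * ∑ t ∈ range (K - J), θ (K - t)) := by
      field_simp
      ring
    linarith only [hsum, hdiv, hstart, hsplit]
  have hsq : ∑ t ∈ range (K - J), s (t + 1) ^ 2 ≤ E₀ + E₁ * ∑ i ∈ range (K - J), (((5 * F.L : ℕ) : ℝ) ^ 2 / 4) * θ (K - i) := by
    have h1 := sum_sq_succ_le_mul_sum_succ s (K - J) M hs0 hall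
    have hS0 : 0 ≤ ∑ t ∈ range (K - J), s (t + 1) := sum_nonneg fun t _ => hs0 _
    have h2 : M * ∑ t ∈ range (K - J), s (t + 1) ≤ 1 * ∑ t ∈ range (K - J), s (t + 1) := mul_le_mul_of_nonneg_right (hM4.trans (by norm_num)) hS0
    linarith only [h1, h2, hmain]
  exact ⟨s, hs0, hsb, fun t ht => (hall t ht).trans hM4, hmain, hsq⟩

/-! ## §2 Two towers at the station prefix: (RSP-Σ) for the raw relative chords, linear in `Σθ_G` -/

/-- ★★★ **(RSP-Σ) AT THE STATION PREFIX, FROM THE GUARD**: for every datum class `G` with the small-bond conjunct, `∃ α₀(L, C_B) > 0, ∃ E₀(L), E₁(L) ≥ 0` and — under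
the station prefix of LEAD's knit VERBATIM — a profile `M ≥ 0` of the RAW relative chords `avg^t(exp(ζ)·U₀)(b)·(avg^t U₀ (b))⁻¹` (`t ≤ K − J`) with `M_t ≤ 1∕2`,
`Σ_{t<K−J} M(t+1) ≤ E₀ + E₁·Σ_{i<K−J} ((5L)²∕4)·θ(K−i)`, same for squares (`M := s + s′`; §1 ×2, memberships as in ✓`arcLetter_of_guard`).
[cite: Balaban1985RegularSpaces, Lemma 1 (1.24)-(1.26) p.79, (1.29) p.81; Balaban1985Averaging, Prop. 4 (128)-(135) pp.37-38] -/
theorem relChordSum_of_guard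
    (G : (F : T3Family) → (J : ℕ) → GaugeField (F.P J) 0 (Matrix.specialUnitaryGroup (Fin 2) ℂ) → Prop)
    (hGs : ∀ (F : T3Family) (J : ℕ) (V : GaugeField (F.P J) 0 (Matrix.specialUnitaryGroup (Fin 2) ℂ)),
      G F J V → ∀ e, ‖logVec (su2Quat (V e))‖ ≤ 1 / 128) :
      ∀ (L : ℕ), 1 < L → ∀ (C_B : ℝ), 0 ≤ C_B → ∃ α₀ : ℝ, 0 < α₀ ∧ ∃ E₀ : ℝ, 0 ≤ E₀ ∧ ∃ E₁ : ℝ, 0 ≤ E₁ ∧ ∀ (F : T3Family), F.L = L →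
      ∀ (J K : ℕ) (hJK : J ≤ K) (θ : ℕ → ℝ), (∀ i, 0 ≤ θ i) → ∀ (α : ℝ), (∀ i, J < i → i ≤ K → (((5 * F.L : ℕ) : ℝ) ^ 2 / 4) * θ i ≤ α) →
        α ≤ 1 / 24 → α < deltaSU (Fin 2) → 157 * α < ((F.L : ℝ) ^ 2)⁻¹ → α ≤ α₀ →
        ∀ U₀ : GaugeField (F.P K) 0 (Matrix.specialUnitaryGroup (Fin 2) ℂ), U₀ ∈ histGood F ℰp θ K J →
        G F J (descendTo F ℰp J K hJK U₀) →
        (∀ t, t ≤ K - J → ∀ p : Plaq (F.P K) t,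
          dist1 (GaugeField.plaqHol (Averaging.iter (fun k => BlockAveraging.blockAvg (P := F.P K) (j := k) ℰp) t U₀) p) ≤
            C_B * α * (F.L : ℝ) ^ (2 * t) * ((F.L : ℝ)⁻¹) ^ (2 * (K - J))) →
        ∀ ζ : PBond (F.P K) 0 → EuclideanSpace ℝ (Fin 3), (∀ ℓ, ‖ζ ℓ‖ ≤ Real.pi) →
          (fun ℓ => expPoint (ζ ℓ) * U₀ ℓ : GaugeField (F.P K) 0 (Matrix.specialUnitaryGroup (Fin 2) ℂ)) ∈ histGood F ℰp θ K J →
            descendTo F ℰp J K hJK (fun ℓ => expPoint (ζ ℓ) * U₀ ℓ : GaugeField (F.P K) 0 (Matrix.specialUnitaryGroup (Fin 2) ℂ)) = descendTo F ℰp J K hJK U₀ →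
            ∀ (wt : (j : ℕ) → PBond (F.P K) j → PBond (F.P K) (j + 1) → ℝ)
            (lift : (j : ℕ) → GaugeField (F.P K) (j + 1) SU2 → GaugeField (F.P K) j SU2)
            (U₁ : GaugeField (F.P K) 0 SU2) (g g₀ : (j : ℕ) → Site (F.P K) j → SU2),
          (∀ j b e, wt j b e = if e.dir = b.dir ∧ (b.src b.dir - emb e.src b.dir).val < (F.P K).L then
              ∏ ν ∈ Finset.univ.erase b.dir, max 0 (1 - ((rel (emb e.src) b.src ν).natAbs : ℝ) / (F.P K).L) else 0) →
          (∀ j X b, lift j X b = expPoint (∑ e, wt j b e • ((((F.P K).L : ℕ) : ℝ)⁻¹ • logVec (su2Quat (X e))))) →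
          (∀ j, j < K - J → ∀ x, g j x =
            (axialT (lift j (GaugeField.gaugeAct (g (j + 1)) (Averaging.iter (fun k => blockAvg (P := F.P K) (j := k) ℰp) (j + 1) (fun ℓ => expPoint (ζ ℓ) * U₀ ℓ))))
                (emb (blockOf x)) x)⁻¹ *
              g (j + 1) (blockOf x) * axialT (Averaging.iter (fun k => blockAvg (P := F.P K) (j := k) ℰp) j (fun ℓ => expPoint (ζ ℓ) * U₀ ℓ)) (emb (blockOf x)) x) →
          (∀ j, K - J ≤ j → ∀ y, g j y = 1) →
          (∀ j, j < K - J → ∀ y : Site (F.P K) (j + 1), g j (emb y) = g (j + 1) y) →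
          (∀ X : GaugeField (F.P K) 0 SU2, ∀ j, j ≤ K - J →
            Averaging.iter (fun k => blockAvg (P := F.P K) (j := k) ℰp) j (GaugeField.gaugeAct (g 0) X) =
              GaugeField.gaugeAct (g j) (Averaging.iter (fun k => blockAvg (P := F.P K) (j := k) ℰp) j X)) →
          (∀ j, j < K - J → ∀ x,
            axialT (GaugeField.gaugeAct (g j) (Averaging.iter (fun k => blockAvg (P := F.P K) (j := k) ℰp) j (fun ℓ => expPoint (ζ ℓ) * U₀ ℓ))) (emb (blockOf x)) x =
              axialT (lift j (GaugeField.gaugeAct (g (j + 1)) (Averaging.iter (fun k => blockAvg (P := F.P K) (j := k) ℰp) (j + 1) (fun ℓ => expPoint (ζ ℓ) * U₀ ℓ))))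
                (emb (blockOf x)) x) →
          (∀ j, j < K - J →
            (blockAvg (P := F.P K) (j := j) ℰp).avg (GaugeField.gaugeAct (g j) (Averaging.iter (fun k => blockAvg (P := F.P K) (j := k) ℰp) j (fun ℓ => expPoint (ζ ℓ) * U₀ ℓ))) =
              GaugeField.gaugeAct (g (j + 1)) (Averaging.iter (fun k => blockAvg (P := F.P K) (j := k) ℰp) (j + 1) (fun ℓ => expPoint (ζ ℓ) * U₀ ℓ))) →
          (∀ j, j < K - J → ∀ x, g₀ j x =
            (axialT (lift j (GaugeField.gaugeAct (g₀ (j + 1)) (Averaging.iter (fun k => blockAvg (P := F.P K) (j := k) ℰp) (j + 1) U₁)))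
                (emb (blockOf x)) x)⁻¹ *
              g₀ (j + 1) (blockOf x) * axialT (Averaging.iter (fun k => blockAvg (P := F.P K) (j := k) ℰp) j U₁) (emb (blockOf x)) x) →
          (∀ j, K - J ≤ j → ∀ y, g₀ j y = 1) →
          (∀ j, j < K - J → ∀ y : Site (F.P K) (j + 1), g₀ j (emb y) = g₀ (j + 1) y) →
          (∀ X : GaugeField (F.P K) 0 SU2, ∀ j, j ≤ K - J →
            Averaging.iter (fun k => blockAvg (P := F.P K) (j := k) ℰp) j (GaugeField.gaugeAct (g₀ 0) X) =
              GaugeField.gaugeAct (g₀ j) (Averaging.iter (fun k => blockAvg (P := F.P K) (j := k) ℰp) j X)) →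
          (∀ j, j < K - J → ∀ x,
            axialT (GaugeField.gaugeAct (g₀ j) (Averaging.iter (fun k => blockAvg (P := F.P K) (j := k) ℰp) j U₁)) (emb (blockOf x)) x =
              axialT (lift j (GaugeField.gaugeAct (g₀ (j + 1)) (Averaging.iter (fun k => blockAvg (P := F.P K) (j := k) ℰp) (j + 1) U₁)))
                (emb (blockOf x)) x) →
          (∀ j, j < K - J →
            (blockAvg (P := F.P K) (j := j) ℰp).avg (GaugeField.gaugeAct (g₀ j) (Averaging.iter (fun k => blockAvg (P := F.P K) (j := k) ℰp) j U₁)) =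
              GaugeField.gaugeAct (g₀ (j + 1)) (Averaging.iter (fun k => blockAvg (P := F.P K) (j := k) ℰp) (j + 1) U₁)) →
          (∀ X : GaugeField (F.P K) 0 SU2, Averaging.iter (fun k => blockAvg (P := F.P K) (j := k) ℰp) (K - J) (GaugeField.gaugeAct (fun x => (g 0 x)⁻¹) X) = Averaging.iter (fun k => blockAvg (P := F.P K) (j := k) ℰp) (K - J) X) →
          (∀ X : GaugeField (F.P K) 0 SU2, Averaging.iter (fun k => blockAvg (P := F.P K) (j := k) ℰp) (K - J) (GaugeField.gaugeAct (g₀ 0) X) = Averaging.iter (fun k => blockAvg (P := F.P K) (j := k) ℰp) (K - J) X) →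
          U₀ = GaugeField.gaugeAct (fun x => (g 0 x)⁻¹ * g₀ 0 x) U₁ →

          ∃ M : ℕ → ℝ, (∀ t, 0 ≤ M t) ∧
            (∀ t, t ≤ K - J → ∀ b : PBond (F.P K) t,
              ‖logVec (su2Quat (Averaging.iter (fun k => blockAvg (P := F.P K) (j := k) ℰp) t
                  (fun ℓ => expPoint (ζ ℓ) * U₀ ℓ : GaugeField (F.P K) 0 (Matrix.specialUnitaryGroup (Fin 2) ℂ)) b *
                (Averaging.iter (fun k => blockAvg (P := F.P K) (j := k) ℰp) t U₀ b)⁻¹))‖ ≤ M t) ∧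
            (∀ t, t ≤ K - J → M t ≤ 1 / 2) ∧
            ∑ t ∈ Finset.range (K - J), M (t + 1) ≤ E₀ + E₁ * ∑ i ∈ Finset.range (K - J), (((5 * F.L : ℕ) : ℝ) ^ 2 / 4) * θ (K - i) ∧
            ∑ t ∈ Finset.range (K - J), M (t + 1) ^ 2 ≤ E₀ + E₁ * ∑ i ∈ Finset.range (K - J), (((5 * F.L : ℕ) : ℝ) ^ 2 / 4) * θ (K - i) := by
  intro L hL C_B hCB
  obtain ⟨α₀, hα₀, E₀, hE₀, E₁, hE₁, H⟩ := exists_alpha_supBudget_window L hL C_B hCB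
  refine ⟨α₀, hα₀, E₀ + E₀, by positivity, E₁ + E₁, by positivity, ?_⟩
  intro F hFL J K hJK θ hθ0 α hwin h24 hδ _h157 hαα U₀ hU₀g hG hBKG ζ _hζ hWg hfib wt lift U₁ g g₀ hwt hlift _hg hgtop _hgemb hT3 hT4 havg
    _hg₀ hg₀top _hg₀emb hT3' hT4' havg₀ hres hres₀ hU₀
  have hV : ∀ e', ‖logVec (su2Quat (descendTo F ℰp J K hJK U₀ e'))‖ ≤ 1 / 128 := hGs F J _ hG
  have hFL0 : (0 : ℝ) < (F.L : ℝ) := by rw [hFL]; exact_mod_cast (lt_trans Nat.zero_lt_one hL)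
  have hLL : (F.L : ℝ) ^ (2 * (K - J)) * ((F.L : ℝ)⁻¹) ^ (2 * (K - J)) = 1 := by
    rw [← mul_pow, mul_inv_cancel₀ hFL0.ne', one_pow]
  have htop₀ : ∀ p : Plaq (F.P K) (K - J),
      dist1 (GaugeField.plaqHol (Averaging.iter (fun k => blockAvg (P := F.P K) (j := k) ℰp) (K - J) U₀) p) ≤ C_B * α := by
    intro p
    have h := hBKG (K - J) le_rfl p
    rw [mul_assoc (C_B * α), hLL, mul_one] at h
    exact h
  -- the partner `W := exp(ζ)·U₀`: in the datum's fibre by (E4) (`hfib` itself), same top field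
  have hWtop : ∀ p : Plaq (F.P K) (K - J),
      dist1 (GaugeField.plaqHol (Averaging.iter (fun k => blockAvg (P := F.P K) (j := k) ℰp) (K - J)
        (fun ℓ => expPoint (ζ ℓ) * U₀ ℓ : GaugeField (F.P K) 0 (Matrix.specialUnitaryGroup (Fin 2) ℂ))) p) ≤ C_B * α := by
    intro p
    rw [iter_eq_of_descendTo_eq F hJK hfib]
    exact htop₀ p
  have hwres : ∀ X : GaugeField (F.P K) 0 SU2,
      descendTo F ℰp J K hJK (GaugeField.gaugeAct (fun x => (g 0 x)⁻¹ * g₀ 0 x) X) = descendTo F ℰp J K hJK X := by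
    refine residual_of_iter_eq F hJK _ fun X => ?_
    have e1 : GaugeField.gaugeAct (fun x => (g 0 x)⁻¹ * g₀ 0 x) X =
        GaugeField.gaugeAct (fun x => (g 0 x)⁻¹) (GaugeField.gaugeAct (g₀ 0) X) := gaugeAct_mul_eq (fun x => (g 0 x)⁻¹) (g₀ 0) X
    rw [e1, hres, hres₀]
  have hU₁f : U₁ ∈ fibre F ℰp J K hJK (descendTo F ℰp J K hJK U₀) := by
    rw [← gaugeAct_mem_fibre_iff_of_residual F hJK hwres U₁, ← hU₀]; exact rfl
  have hU₁g : U₁ ∈ histGood F ℰp θ K J := by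
    rw [← gaugeAct_mem_histGood_iff F (fun x => (g 0 x)⁻¹ * g₀ 0 x) θ J U₁, ← hU₀]; exact hU₀g
  have hU₁top : ∀ p : Plaq (F.P K) (K - J),
      dist1 (GaugeField.plaqHol (Averaging.iter (fun k => blockAvg (P := F.P K) (j := k) ℰp) (K - J) U₁) p) ≤ C_B * α := by
    intro p
    have e1 : Averaging.iter (fun k => blockAvg (P := F.P K) (j := k) ℰp) (K - J) U₁ =
        Averaging.iter (fun k => blockAvg (P := F.P K) (j := k) ℰp) (K - J) U₀ := by
      have e2 : GaugeField.gaugeAct (fun x => (g 0 x)⁻¹ * g₀ 0 x) U₁ =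
          GaugeField.gaugeAct (fun x => (g 0 x)⁻¹) (GaugeField.gaugeAct (g₀ 0) U₁) := gaugeAct_mul_eq (fun x => (g 0 x)⁻¹) (g₀ 0) U₁
      rw [hU₀, e2, hres, hres₀]
    rw [e1]
    exact htop₀ p
  obtain ⟨s, hs0, hs, hs4, hsE, -⟩ := H F θ hFL hθ0 J K hJK α hwin h24 hδ hαα (descendTo F ℰp J K hJK U₀) hV _ hfib hWg hWtop g wt
    (fun t => lift t (GaugeField.gaugeAct (g (t + 1)) (Averaging.iter (fun k => blockAvg (P := F.P K) (j := k) ℰp) (t + 1)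
      (fun ℓ => expPoint (ζ ℓ) * U₀ ℓ : GaugeField (F.P K) 0 (Matrix.specialUnitaryGroup (Fin 2) ℂ)))))
    (fun t _ b e' => hwt t b e') (fun t _ b => hlift t _ b) hgtop (fun t ht z => hT4 t ht z) (fun t ht => havg t ht)
  obtain ⟨s', hs0', hs', hs4', hsE', -⟩ := H F θ hFL hθ0 J K hJK α hwin h24 hδ hαα (descendTo F ℰp J K hJK U₀) hV U₁ hU₁f hU₁g hU₁top g₀ wt
    (fun t => lift t (GaugeField.gaugeAct (g₀ (t + 1)) (Averaging.iter (fun k => blockAvg (P := F.P K) (j := k) ℰp) (t + 1) U₁)))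
    (fun t _ b e' => hwt t b e') (fun t _ b => hlift t _ b) hg₀top (fun t ht z => hT4' t ht z) (fun t ht => havg₀ t ht)
  refine ⟨fun t => s t + s' t, fun t => add_nonneg (hs0 t) (hs0' t), fun t ht b => ?_, fun t ht => by linarith only [hs4 t ht, hs4' t ht], ?_, ?_⟩
  · rw [norm_logVec_rawChord_eq_stageChord (fun k => blockAvg (P := F.P K) (j := k) ℰp) g g₀ _ U₁ U₀ (fun X => hT3 X t ht) (fun X => hT3' X t ht) hU₀ b]
    exact (norm_logVec_mul_inv_le_add _ _).trans (add_le_add (hs t ht b) (hs' t ht b))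
  · rw [Finset.sum_add_distrib, add_mul]; linarith only [hsE, hsE']
  · -- squares: `M ≤ 1∕2 ≤ 1` ⟹ `M² ≤ M`
    have hle : ∑ t ∈ Finset.range (K - J), (s (t + 1) + s' (t + 1)) ^ 2 ≤ ∑ t ∈ Finset.range (K - J), (s (t + 1) + s' (t + 1)) := by
      refine Finset.sum_le_sum fun t ht => ?_
      have ht' : t + 1 ≤ K - J := by have := Finset.mem_range.mp ht; omega
      have hx1 : s (t + 1) + s' (t + 1) ≤ 1 := by linarith only [hs4 (t + 1) ht', hs4' (t + 1) ht']
      have hx0 : 0 ≤ s (t + 1) + s' (t + 1) := add_nonneg (hs0 (t + 1)) (hs0' (t + 1))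
      calc (s (t + 1) + s' (t + 1)) ^ 2 = (s (t + 1) + s' (t + 1)) * (s (t + 1) + s' (t + 1)) := sq _
        _ ≤ 1 * (s (t + 1) + s' (t + 1)) := mul_le_mul_of_nonneg_right hx1 hx0
        _ = s (t + 1) + s' (t + 1) := one_mul _
    refine hle.trans ?_
    rw [Finset.sum_add_distrib, add_mul]; linarith only [hsE, hsE']

end Summit.QuantumFields.YangMills.Theorems.FluctuationComparisonRegPrIntLS2BetaRelChordSumOfGuard

end
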